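import Summits.ResolutionOfSingularities.ResolutionOfSingularities.Theorems.ValuativeLupiLaurentBase
import Literature.AlgebraicGeometry.Resolution.ResolutionLU
import Literature.AlgebraicGeometry.Resolution.Temkin2013Curves
import Literature.AlgebraicGeometry.Resolution.GeneralLU
import Literature.AlgebraicGeometry.Resolution.ArithmeticalThreefolds
import Literature.AlgebraicGeometry.Resolution.AffineDomainDimension
import HarnessLib

/-!
# Route `Valuative`, item `Lupi` (stmt-ResolutionOfSingularities-0560): reductions and known cases

`Lupi` (LUPI_p): for every prime `p`, field `k` of characteristic `p`, `K = k(x₁,…,xₙ,t)` with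
`x` algebraically independent over `k` and `t ^ p ∈ k[x]` (the function field of the Zariski
hypersurface `t^p = f(x)`), every valuation ring `O ⊇ k` of `K` is locally uniformizable over
`k`: some finitely generated `k`-subalgebra `A ⊆ O` with `Frac A = K` is regular at the centre
`𝔪_O ∩ A`.  This is absolute local uniformization of purely inseparable hypersurface function
fields; by Temkin 2013, Rem. 1.3.5(iii) it carries local uniformization in characteristic `p`,
OPEN for `n ≥ 4` (Cutkosky–Mourtada 2019: embedded LU unknown in dimension 4).

What is kernel-checked here:

* `lupi_iff` — the conclusion of `Lupi` is literally `IsLocallyUniformizable k K O`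
  (`Literature/AlgebraicGeometry/Resolution/LocalUniformization.lean`).
* `lupi_of_luAlphaPTorsor : LuAlphaPTorsor → Lupi` — **the item is a corollary of the crux
  `LuAlphaPTorsor` (stmt-0641)**, as the planner's retriage note (2026-08-14) says: along `O`,
  the Laurent base `A₀ := k[y] ⊆ O` (`yᵢ ∈ {xᵢ, xᵢ⁻¹}`, a polynomial ring, regular at the
  centre) and the twisted root `t' := (∏ yᵢ) ^ m * t` with `t' ^ p ∈ A₀`, `Frac (A₀[t']) = K`
  (`exists_datum_mem`, `ValuativeLupiLaurentBase.lean`) form a torsor datum; the crux returns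
  the uniformizing model.  Pointwise in `p`: `at_of_luAlphaPTorsorAt`.
* `lupi_iff_mem` — NORMAL FORM: it suffices to treat valuation rings `O` CONTAINING every
  `xᵢ` (centre on the chart `k[x] = 𝔸ⁿ`).
* Unconditional cases: `isLocallyUniformizable_of_mem_adjoin` (the rational case `t ∈ k(x)`,
  every `n`, every `k`: the model `k[y]` itself), `lupi_le_one` (`n ≤ 1`, every `k`: tree
  `isLocallyUniformizable_of_trdeg_le_one`).
* `lupi_le_two`, `lupi_le_three` — `n ≤ 2` conditionally on the vendored fact
  `CossartJannsenSaito2020` (surfaces), `n ≤ 3` conditionally on `CossartPiltant2019`.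
* `lupi_of_reduced` — modulo `CossartPiltant2019`, `Lupi` REDUCES to its instances with
  `4 ≤ n`, `t ∉ k(x)` and `x ⊆ O`; `lupi_of_reduced_two` — unconditionally to `2 ≤ n`,
  `t ∉ k(x)`, `x ⊆ O`.  (The further exclusions `t ^ p ∉ k` and "`O` not an Abhyankar place"
  are `ValuativeLupiConstantField.lean`, `ValuativeLupiAbhyankarPlaces.lean` and the combined
  reduction in `ValuativeLupiReductions.lean`.)
* `lupi_of_localUniformizationInChar`, `lupi_of_valuativeThesisRel`,
  `lupi_of_resolutionOfSingularities` — the item sits below `LU_p`, below the route target, and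
  below the summit (so `¬ Lupi` would refute resolution in characteristic `p`).

Log: (1) direct from `ValuativeLupiLaurentBase.lean` and the tree's LU library.
-/

-- single-problem summit: the doubled namespace component `ResolutionOfSingularities` is forced
set_option linter.dupNamespace false

open IsLocalRing

namespace Summit.ResolutionOfSingularities.ResolutionOfSingularities.Theorems.Lupi

open Summit.ResolutionOfSingularities.ResolutionOfSingularities.Theses.Valuative
  (Lupi LuAlphaPTorsor ValuativeThesisRel)
open Literature.AlgebraicGeometry.Resolution

/-! ## The item in the tree's vocabulary -/

/-- `Lupi` says: every valuation ring `O ⊇ k` of a purely inseparable hypersurface function field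
`K = k(x, t)`, `t ^ p ∈ k[x]`, is locally uniformizable over `k` (`IsLocallyUniformizable`,
definitional). -/
theorem lupi_iff :
    Lupi ↔ ∀ p : ℕ, p.Prime → ∀ (k K : Type) [Field k] [CharP k p] [Field K] [Algebra k K]
      (n : ℕ) (x : Fin n → K) (t : K), AlgebraicIndependent k x →
      t ^ p ∈ Algebra.adjoin k (Set.range x) →
      IntermediateField.adjoin k (insert t (Set.range x)) = ⊤ →
      ∀ O : ValuationSubring K, (∀ c : k, algebraMap k K c ∈ O) →
        IsLocallyUniformizable k K O :=
  Iff.rfl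

/-! ## The item from the crux `LuAlphaPTorsor` (stmt-0641) -/

section FromTorsor

/-- **`Lupi` at the prime `p` follows from the crux `LuAlphaPTorsor` at `p`** (hypothesis `H` is
the body of `LuAlphaPTorsor` at `p`, verbatim): apply it to the torsor datum
`(A₀, t') = (k[y], (∏ yᵢ) ^ m * t)` of `exists_datum_mem`, whose base is a polynomial ring. -/
theorem at_of_luAlphaPTorsorAt {p : ℕ} (hp : p.Prime)
    (H : ∀ (k K : Type) [Field k] [CharP k p] [Field K] [Algebra k K] (O : ValuationSubring K)
      (A₀ : Subalgebra k K) (h₀ : A₀.toSubring ≤ O.toSubring) (t : K), A₀.FG → t ^ p ∈ A₀ →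
      IsFractionRing (Algebra.adjoin k (insert t (A₀ : Set K))) K →
      IsRegularLocalRing (Localization.AtPrime (Ideal.comap (Subring.inclusion h₀)
        (IsLocalRing.maximalIdeal O))) →
      ∃ (A : Subalgebra k K) (h : A.toSubring ≤ O.toSubring), A₀ ≤ A ∧ t ∈ A ∧ A.FG ∧
        IsFractionRing A K ∧ IsRegularLocalRing (Localization.AtPrime
          (Ideal.comap (Subring.inclusion h) (IsLocalRing.maximalIdeal O))))
    (k K : Type) [Field k] [CharP k p] [Field K] [Algebra k K] (n : ℕ) (x : Fin n → K) (t : K)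
    (hx : AlgebraicIndependent k x) (htp : t ^ p ∈ Algebra.adjoin k (Set.range x))
    (htop : IntermediateField.adjoin k (insert t (Set.range x)) = ⊤)
    (O : ValuationSubring K) (hO : ∀ c : k, algebraMap k K c ∈ O) :
    IsLocallyUniformizable k K O := by
  obtain ⟨y, t', hyO, hy, ht'p, htop'⟩ := exists_datum_mem x t hp.ne_zero hx htp htop O
  have h₀ : (Algebra.adjoin k (Set.range y)).toSubring ≤ O.toSubring :=
    adjoin_range_toSubring_le O hO hyO
  obtain ⟨A, h, -, -, hAfg, hAfr, hreg⟩ := H k K O (Algebra.adjoin k (Set.range y)) h₀ t'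
    (fg_adjoin_range y) ht'p (isFractionRing_adjoin_insert_of_adjoin_eq_top _ t' htop')
    (isRegularLocalRing_centre_adjoin_range O hy h₀)
  exact ⟨A, h, hAfg, hAfr, hreg⟩

/-- **`LuAlphaPTorsor → Lupi`**: the item stmt-0560 is a corollary of the crux stmt-0641
(retriage 2026-08-14: "closes for free from 0641"). -/
theorem lupi_of_luAlphaPTorsor (H : LuAlphaPTorsor) : Lupi :=
  fun p hp k K _ _ _ _ n x t hx htp htop O hO =>
    at_of_luAlphaPTorsorAt hp (H p hp) k K n x t hx htp htop O hO

end FromTorsor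

/-! ## Normal form: the centre on the chart `k[x]` -/

/-- **Normal form of `Lupi`**: it is equivalent to its restriction to valuation rings `O`
containing every `xᵢ` (replace `xᵢ ∉ O` by `xᵢ⁻¹` and twist `t`, `exists_datum_mem`). -/
theorem lupi_iff_mem :
    Lupi ↔ ∀ p : ℕ, p.Prime → ∀ (k K : Type) [Field k] [CharP k p] [Field K] [Algebra k K]
      (n : ℕ) (x : Fin n → K) (t : K), AlgebraicIndependent k x →
      t ^ p ∈ Algebra.adjoin k (Set.range x) →
      IntermediateField.adjoin k (insert t (Set.range x)) = ⊤ →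
      ∀ O : ValuationSubring K, (∀ c : k, algebraMap k K c ∈ O) → (∀ i, x i ∈ O) →
        IsLocallyUniformizable k K O := by
  refine ⟨fun H p hp k K _ _ _ _ n x t hx htp htop O hO _ => H p hp k K n x t hx htp htop O hO,
    fun H p hp k K _ _ _ _ n x t hx htp htop O hO => ?_⟩
  obtain ⟨y, t', hyO, hy, ht'p, htop'⟩ := exists_datum_mem x t hp.ne_zero hx htp htop O
  exact H p hp k K n y t' hy ht'p htop' O hO hyO

/-! ## Unconditional cases -/

section Unconditional

variable {k K : Type} [Field k] [Field K] [Algebra k K]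

/-- **The rational case `t ∈ k(x)`** (so `K = k(x)` is purely transcendental), every `n`, every
`k`, every `O`: the Laurent base `k[y] ⊆ O` itself is a regular affine model. -/
theorem isLocallyUniformizable_of_mem_adjoin {n : ℕ} (x : Fin n → K) (t : K) {p : ℕ} (hp : p ≠ 0)
    (hx : AlgebraicIndependent k x) (htp : t ^ p ∈ Algebra.adjoin k (Set.range x))
    (htop : IntermediateField.adjoin k (insert t (Set.range x)) = ⊤)
    (ht : t ∈ IntermediateField.adjoin k (Set.range x))
    (O : ValuationSubring K) (hO : ∀ c : k, algebraMap k K c ∈ O) :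
    IsLocallyUniformizable k K O := by
  classical
  obtain ⟨y, hyO, hy⟩ := exists_eq_or_eq_inv_mem O x
  have halg := isAlgebraic_adjoin_range x t hp htp htop
  have hyind : AlgebraicIndependent k y := algebraicIndependent_of_eq_or_eq_inv hx halg hy
  have h₀ : (Algebra.adjoin k (Set.range y)).toSubring ≤ O.toSubring :=
    adjoin_range_toSubring_le O hO hyO
  refine ⟨Algebra.adjoin k (Set.range y), h₀, fg_adjoin_range y, ?_,
    isRegularLocalRing_centre_adjoin_range O hyind h₀⟩
  apply isFractionRing_of_adjoin_eq_top
  apply top_le_iff.mp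
  set F := IntermediateField.adjoin k ((Algebra.adjoin k (Set.range y) : Subalgebra k K) : Set K)
    with hF
  have hyF : ∀ i, y i ∈ F := fun i =>
    IntermediateField.subset_adjoin k _ (Algebra.subset_adjoin ⟨i, rfl⟩)
  have hxF : IntermediateField.adjoin k (Set.range x) ≤ F := by
    rw [IntermediateField.adjoin_le_iff]
    rintro _ ⟨i, rfl⟩
    exact mem_of_eq_or_eq_inv hy hyF i
  rw [← htop, IntermediateField.adjoin_le_iff]
  rintro z (rfl | ⟨i, rfl⟩)
  · exact hxF ht
  · exact mem_of_eq_or_eq_inv hy hyF i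

/-- **`n ≤ 1`** (curves and constants), every `p`, every `k`: local uniformization of function
fields of transcendence degree `≤ 1` is proved in the tree
(`isLocallyUniformizable_of_trdeg_le_one`: Temkin 2013 Thm. 1.3.2 for curves, i.e.
Zariski–Samuel VI §14 Thm. 31, no extension of `K` needed). -/
theorem isLocallyUniformizable_of_le_one {n : ℕ} (hn : n ≤ 1) (x : Fin n → K) (t : K) {p : ℕ}
    (hp : p ≠ 0) (hx : AlgebraicIndependent k x) (htp : t ^ p ∈ Algebra.adjoin k (Set.range x))
    (htop : IntermediateField.adjoin k (insert t (Set.range x)) = ⊤)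
    (O : ValuationSubring K) (hO : ∀ c : k, algebraMap k K c ∈ O) :
    IsLocallyUniformizable k K O := by
  refine isLocallyUniformizable_of_trdeg_le_one O hO (fg_top_of_adjoin_eq_top x t htop) ?_
  rw [trdeg_eq x t hp hx htp htop]
  exact_mod_cast hn

/-- `Lupi` restricted to `n ≤ 1` holds outright (in the item's own binder shape). -/
theorem lupi_le_one : ∀ p : ℕ, p.Prime → ∀ (k K : Type) [Field k] [CharP k p] [Field K]
    [Algebra k K] (n : ℕ) (x : Fin n → K) (t : K), n ≤ 1 → AlgebraicIndependent k x →
      t ^ p ∈ Algebra.adjoin k (Set.range x) →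
      IntermediateField.adjoin k (insert t (Set.range x)) = ⊤ →
      ∀ O : ValuationSubring K, (∀ c : k, algebraMap k K c ∈ O) →
        IsLocallyUniformizable k K O :=
  fun _ hp _ _ _ _ _ _ _ x t hn hx htp htop O hO =>
    isLocallyUniformizable_of_le_one hn x t hp.ne_zero hx htp htop O hO

/-- **Unconditional reduction**: `Lupi` follows from its instances with `2 ≤ n`, `t ∉ k(x)` and
every `xᵢ ∈ O`. -/
theorem lupi_of_reduced_two
    (H : ∀ p : ℕ, p.Prime → ∀ (k K : Type) [Field k] [CharP k p] [Field K] [Algebra k K]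
      (n : ℕ) (x : Fin n → K) (t : K), 2 ≤ n → AlgebraicIndependent k x →
      t ^ p ∈ Algebra.adjoin k (Set.range x) → t ∉ IntermediateField.adjoin k (Set.range x) →
      IntermediateField.adjoin k (insert t (Set.range x)) = ⊤ →
      ∀ O : ValuationSubring K, (∀ c : k, algebraMap k K c ∈ O) → (∀ i, x i ∈ O) →
        IsLocallyUniformizable k K O) : Lupi := by
  refine lupi_iff_mem.mpr fun p hp k K _ _ _ _ n x t hx htp htop O hO hxO => ?_
  by_cases ht : t ∈ IntermediateField.adjoin k (Set.range x)
  · exact isLocallyUniformizable_of_mem_adjoin x t hp.ne_zero hx htp htop ht O hO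
  by_cases hn : n ≤ 1
  · exact isLocallyUniformizable_of_le_one hn x t hp.ne_zero hx htp htop O hO
  · exact H p hp k K n x t (by omega) hx htp ht htop O hO hxO

end Unconditional

/-! ## `n ≤ 2` from Cossart–Jannsen–Saito 2020, `n ≤ 3` from Cossart–Piltant 2019 -/

section DimThree

variable {k K : Type} [Field k] [Field K] [Algebra k K]

/-- **`n ≤ 3`**, every `p`, every `k`, conditionally on the vendored fact `CossartPiltant2019`
(resolution of reduced quasi-excellent schemes of dimension `≤ 3`, Cossart–Piltant 2019
Thm. 1.1, through the tree's `CossartPiltant2019.relLocalUniformization`). -/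
theorem isLocallyUniformizable_of_le_three (hCP : CossartPiltant2019.{0}) {n : ℕ} (hn : n ≤ 3)
    (x : Fin n → K) (t : K) {p : ℕ} (hp : p ≠ 0) (hx : AlgebraicIndependent k x)
    (htp : t ^ p ∈ Algebra.adjoin k (Set.range x))
    (htop : IntermediateField.adjoin k (insert t (Set.range x)) = ⊤)
    (O : ValuationSubring K) (hO : ∀ c : k, algebraMap k K c ∈ O) :
    IsLocallyUniformizable k K O := by
  have hK : Algebra.trdeg k K ≤ 3 := by
    rw [trdeg_eq x t hp hx htp htop]
    exact_mod_cast hn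
  obtain ⟨R, hRO, hRfg, hRfr⟩ :=
    exists_affineModel k K (fg_top_of_adjoin_eq_top x t htop) O hO
  obtain ⟨A, h, hle, hAfg, hreg⟩ := hCP.relLocalUniformization k K hK O R hRfg hRfr hRO
  exact ⟨A, h, hAfg, isFractionRing_of_le hle hRfr, hreg⟩

/-- **`n ≤ 2`**, every `p`, every `k`, conditionally on the vendored fact
`CossartJannsenSaito2020` alone (resolution of excellent surfaces, Cossart–Jannsen–Saito 2020
Thm. 1.2 / Lipman 1978; weaker input than `CossartPiltant2019`, through the tree's
`ResolutionOverUpToDim.localUniformization` and the dimension theorem `dim = trdeg`). -/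
theorem isLocallyUniformizable_of_le_two (hCJS : CossartJannsenSaito2020.{0}) {n : ℕ} (hn : n ≤ 2)
    (x : Fin n → K) (t : K) {p : ℕ} (hp : p ≠ 0) (hx : AlgebraicIndependent k x)
    (htp : t ^ p ∈ Algebra.adjoin k (Set.range x))
    (htop : IntermediateField.adjoin k (insert t (Set.range x)) = ⊤)
    (O : ValuationSubring K) (hO : ∀ c : k, algebraMap k K c ∈ O) :
    IsLocallyUniformizable k K O := by
  have hK : Algebra.trdeg k K ≤ 2 := by
    rw [trdeg_eq x t hp hx htp htop]
    exact_mod_cast hn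
  obtain ⟨R, hRO, hRfg, hRfr⟩ :=
    exists_affineModel k K (fg_top_of_adjoin_eq_top x t htop) O hO
  haveI := hRfr
  obtain ⟨A, h, hle, hAfg, hreg⟩ := (hCJS k).localUniformization K O R hRO hRfg hRfr
    (ringKrullDim_le_of_fg_of_trdeg_le R hRfg (by exact_mod_cast hK))
  exact ⟨A, h, hAfg, isFractionRing_of_le hle hRfr, hreg⟩

/-- `Lupi` restricted to `n ≤ 2`, conditionally on `CossartJannsenSaito2020`. -/
theorem lupi_le_two (hCJS : CossartJannsenSaito2020.{0}) : ∀ p : ℕ, p.Prime → ∀ (k K : Type)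
    [Field k] [CharP k p] [Field K] [Algebra k K] (n : ℕ) (x : Fin n → K) (t : K), n ≤ 2 →
      AlgebraicIndependent k x → t ^ p ∈ Algebra.adjoin k (Set.range x) →
      IntermediateField.adjoin k (insert t (Set.range x)) = ⊤ →
      ∀ O : ValuationSubring K, (∀ c : k, algebraMap k K c ∈ O) →
        IsLocallyUniformizable k K O :=
  fun _ hp _ _ _ _ _ _ _ x t hn hx htp htop O hO =>
    isLocallyUniformizable_of_le_two hCJS hn x t hp.ne_zero hx htp htop O hO

/-- `Lupi` restricted to `n ≤ 3`, conditionally on `CossartPiltant2019`. -/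
theorem lupi_le_three (hCP : CossartPiltant2019.{0}) : ∀ p : ℕ, p.Prime → ∀ (k K : Type) [Field k]
    [CharP k p] [Field K] [Algebra k K] (n : ℕ) (x : Fin n → K) (t : K), n ≤ 3 →
      AlgebraicIndependent k x → t ^ p ∈ Algebra.adjoin k (Set.range x) →
      IntermediateField.adjoin k (insert t (Set.range x)) = ⊤ →
      ∀ O : ValuationSubring K, (∀ c : k, algebraMap k K c ∈ O) →
        IsLocallyUniformizable k K O :=
  fun _ hp _ _ _ _ _ _ _ x t hn hx htp htop O hO =>
    isLocallyUniformizable_of_le_three hCP hn x t hp.ne_zero hx htp htop O hO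

/-- **Reduction modulo Cossart–Piltant**: given `CossartPiltant2019`, `Lupi` follows from its
instances with `4 ≤ n`, `t ∉ k(x)` and every `xᵢ ∈ O` — the open case as printed
(Temkin 2013 Rem. 1.3.5(iii); Cutkosky–Mourtada 2019: dimension `4`). -/
theorem lupi_of_reduced (hCP : CossartPiltant2019.{0})
    (H : ∀ p : ℕ, p.Prime → ∀ (k K : Type) [Field k] [CharP k p] [Field K] [Algebra k K]
      (n : ℕ) (x : Fin n → K) (t : K), 4 ≤ n → AlgebraicIndependent k x →
      t ^ p ∈ Algebra.adjoin k (Set.range x) → t ∉ IntermediateField.adjoin k (Set.range x) →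
      IntermediateField.adjoin k (insert t (Set.range x)) = ⊤ →
      ∀ O : ValuationSubring K, (∀ c : k, algebraMap k K c ∈ O) → (∀ i, x i ∈ O) →
        IsLocallyUniformizable k K O) : Lupi := by
  refine lupi_of_reduced_two fun p hp k K _ _ _ _ n x t _ hx htp ht htop O hO hxO => ?_
  by_cases hn : n ≤ 3
  · exact isLocallyUniformizable_of_le_three hCP hn x t hp.ne_zero hx htp htop O hO
  · exact H p hp k K n x t (by omega) hx htp ht htop O hO hxO

end DimThree

/-! ## Position: the item below `LU_p`, the route target and the summit -/

/-- `LU_p` for all primes `p` (`LocalUniformizationInChar`) implies `Lupi` (special function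
fields). -/
theorem lupi_of_localUniformizationInChar
    (H : ∀ p : ℕ, p.Prime → LocalUniformizationInChar.{0} p) : Lupi :=
  fun p hp k K _ _ _ _ _ x t _ _ htop O hO => H p hp k K (fg_top_of_adjoin_eq_top x t htop) O hO

/-- The route target `ValuativeThesisRel` (relative LU in every characteristic `p`, first
conjunct, with `R := k`) implies `Lupi`. -/
theorem lupi_of_valuativeThesisRel (H : ValuativeThesisRel) : Lupi := by
  intro p hp k K _ _ _ _ n x t _ _ htop O hO
  obtain ⟨A, h, -, hAfg, hAfr, hreg⟩ := (H p hp).1 k K (fg_top_of_adjoin_eq_top x t htop) O hO ⊥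
    Subalgebra.fg_bot (fun z hz => by
      obtain ⟨c, rfl⟩ := Algebra.mem_bot.mp hz
      exact hO c)
  exact ⟨A, h, hAfg, hAfr, hreg⟩

/-- **The summit implies the item** (through `ResolutionInChar.localUniformizationInChar`,
Zariski 1940 read backwards); so `¬ Lupi` would refute resolution of singularities in some
positive characteristic. -/
theorem lupi_of_resolutionOfSingularities (H : _root_.ResolutionOfSingularities) : Lupi :=
  lupi_of_localUniformizationInChar fun p hp => (H p hp).localUniformizationInChar

end Summit.ResolutionOfSingularities.ResolutionOfSingularities.Theorems.Lupi
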